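import Mathlib
import Summits.NavierStokesRegularity.NavierStokesRegularity.Theorems.EulerZoomLiouvillePowerGaugeEulerLiouvilleCondenserWeightedQuietSlice

/-!
# (Q″) THE `s²`-WEIGHTED QUIET SLICE ON A WINDOW OF HEIGHTS, SLAB BUDGET (nsreg-p2 g36 ROUND-46 «THE KINEMATIC CEILING» §1, plate t48-Q″)

Width piece for crux `EulerZoomLiouville.PowerGaugeEulerLiouville` (stmt-NavierStokesRegularity-19832), by name under LEAD 19832
(ns-typeII-p2 g13); seat ns-sfl-p1 g7, `--supports stmt-NavierStokesRegularity-19832 --as helper`.  Text = nsreg-p2 g36's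
`r46/Sketch46.lean` (sha16 7c4c548940e39666) Prop `NsregP2.R46.WeightedQuietSliceShell` binder-for-binder (`E3` spelled out,
`plane` = `Condenser.plane`).

It is t47-Q (`Condenser.weightedQuietSlice_of`, window `[R, ΛR]`) with the window of heights `[ℓ₁, ℓ₂]` and the `G`-budget taken on
the SLAB `B(0,R') ∩ {ℓ₁ ≤ x₂}` only (the `F`-budget stays on the ball):
`F, G ≥ 0` continuous, `∫_{B(0,R')} F ≤ X`, `∫_{B(0,R') ∩ {ℓ₁ ≤ x₂}} G ≤ Y`, `0 < ℓ₁ < ℓ₂`, `0 < η < 1` ⇒ some height `s ∈ [ℓ₁, ℓ₂]`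
has `∫ 𝟙_{B(0,R')}F ∘ plane s ≤ X/(η(ℓ₂−ℓ₁))` AND `∫ 𝟙_{B(0,R')}G ∘ plane s ≤ 3Y s²/((ℓ₁+(1−η)(ℓ₂−ℓ₁))³ − ℓ₁³)`
(at `ℓ₁ = R`, `ℓ₂ = ΛR` these are t47-Q's constants).
Proof = t47-Q's verbatim: Markov for `F` on `[ℓ₁, ℓ₂]` leaves a good set of heights of measure `≥ (1−η)(ℓ₂−ℓ₁)`; the slab slice
integral `s ↦ ∫ 𝟙_{B(0,R') ∩ {ℓ₁ ≤ x₂}} G ∘ plane s` has total `≤ Y` (`Condenser.integral_integral_plane`) and COINCIDES with the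
ball slice integral at every height `s ≥ ℓ₁` (`plane s a 2 = s`); if on the good set every `G`-slice exceeded `λ s²`, the BATHTUB
principle (`Condenser.setIntegral_sq_ge_bathtub`) would give `∫ G`-slices `> λ·∫_{ℓ₁}^{ℓ₁+(1−η)(ℓ₂−ℓ₁)} s² ds = Y`.

HONEST FRAMING: measure theory on coordinate slices of `ℝ³`; nothing here proves the crux E (19832 OPEN), any door Target, or any
Navier–Stokes statement; MODEL lattice only. [folklore (Markov, bathtub principle)]
-/

noncomputable section

open Set Filter Topology Metric Function MeasureTheory Real

set_option linter.dupNamespace false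

namespace Summit.NavierStokesRegularity.NavierStokesRegularity.Theorems.PowerGaugeEulerLiouville.Condenser

/-! ## Slab slices -/

/-- The truncation `𝟙_{B(0,r) ∩ {ℓ ≤ x₂}} G` of a continuous function to a slab of a ball is integrable. [folklore] -/
theorem integrable_indicator_ballSlab_of_continuous {G : EuclideanSpace ℝ (Fin 3) → ℝ}
    (hGc : Continuous G) (r ℓ : ℝ) :
    Integrable ((ball (0 : EuclideanSpace ℝ (Fin 3)) r ∩ {x | ℓ ≤ x 2}).indicator G) := by
  have hm : MeasurableSet {x : EuclideanSpace ℝ (Fin 3) | ℓ ≤ x 2} :=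
    measurableSet_le measurable_const ((EuclideanSpace.proj (2 : Fin 3)).continuous.measurable)
  exact (integrable_indicator_iff (measurableSet_ball.inter hm)).mpr
    ((hGc.continuousOn.integrableOn_compact (isCompact_closedBall 0 r)).mono_set
      (inter_subset_left.trans ball_subset_closedBall))

/-- At a height `s ≥ ℓ` the slab slice is the ball slice:
`𝟙_{B(0,r) ∩ {ℓ ≤ x₂}} G (plane s a) = 𝟙_{B(0,r)} G (plane s a)` (`plane s a 2 = s`). [folklore] -/
theorem indicator_ballSlab_plane_of_le {G : EuclideanSpace ℝ (Fin 3) → ℝ} {r ℓ s : ℝ} (hs : ℓ ≤ s)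
    (a : EuclideanSpace ℝ (Fin 2)) :
    (ball (0 : EuclideanSpace ℝ (Fin 3)) r ∩ {x | ℓ ≤ x 2}).indicator G (plane s a) =
      (ball (0 : EuclideanSpace ℝ (Fin 3)) r).indicator G (plane s a) := by
  have hmem : plane s a ∈ {x : EuclideanSpace ℝ (Fin 3) | ℓ ≤ x 2} := by
    rw [mem_setOf_eq, plane_apply_two]; exact hs
  by_cases hb : plane s a ∈ ball (0 : EuclideanSpace ℝ (Fin 3)) r
  · have hb' : plane s a ∈ ball (0 : EuclideanSpace ℝ (Fin 3)) r ∩ {x | ℓ ≤ x 2} := ⟨hb, hmem⟩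
    rw [indicator_of_mem hb', indicator_of_mem hb]
  · rw [indicator_of_notMem (fun h => hb h.1), indicator_of_notMem hb]

/-- The slab slice integral is nonnegative for `G ≥ 0`. [folklore] -/
theorem integral_indicator_ballSlab_plane_nonneg {G : EuclideanSpace ℝ (Fin 3) → ℝ} (hG0 : ∀ x, 0 ≤ G x)
    (r ℓ s : ℝ) :
    0 ≤ ∫ a, (ball (0 : EuclideanSpace ℝ (Fin 3)) r ∩ {x | ℓ ≤ x 2}).indicator G (plane s a) :=
  integral_nonneg fun _ => Set.indicator_nonneg (fun x _ => hG0 x) _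

/-- The total of the slab slice integrals is the slab integral:
`∫ s, ∫ a, 𝟙_{B(0,r) ∩ {ℓ ≤ x₂}} G (plane s a) = ∫_{B(0,r) ∩ {ℓ ≤ x₂}} G`. [folklore] -/
theorem integral_integral_indicator_ballSlab_plane {G : EuclideanSpace ℝ (Fin 3) → ℝ} (hGc : Continuous G)
    (r ℓ : ℝ) :
    ∫ s, ∫ a, (ball (0 : EuclideanSpace ℝ (Fin 3)) r ∩ {x | ℓ ≤ x 2}).indicator G (plane s a)
      = ∫ x in ball (0 : EuclideanSpace ℝ (Fin 3)) r ∩ {x | ℓ ≤ x 2}, G x := by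
  have hm : MeasurableSet {x : EuclideanSpace ℝ (Fin 3) | ℓ ≤ x 2} :=
    measurableSet_le measurable_const ((EuclideanSpace.proj (2 : Fin 3)).continuous.measurable)
  rw [integral_integral_plane _ (integrable_indicator_ballSlab_of_continuous hGc r ℓ),
    integral_indicator (measurableSet_ball.inter hm)]

/-! ## The weighted quiet slice on a window, slab budget -/

/-- **(Q″) THE `s²`-WEIGHTED QUIET SLICE ON A WINDOW OF HEIGHTS, SLAB BUDGET.**  See the module docstring.
[folklore (Markov, bathtub principle)] -/
theorem weightedQuietSliceShell_of {F G : EuclideanSpace ℝ (Fin 3) → ℝ} (hFc : Continuous F) (hGc : Continuous G)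
    (hF0 : ∀ x, 0 ≤ F x) (hG0 : ∀ x, 0 ≤ G x) {ℓ₁ ℓ₂ R' η X Y : ℝ} (hℓ₁ : 0 < ℓ₁) (hℓ : ℓ₁ < ℓ₂) (hη : 0 < η)
    (hη1 : η < 1) (hX : 0 < X) (hY : 0 < Y)
    (hFX : ∫ x in ball (0 : EuclideanSpace ℝ (Fin 3)) R', F x ≤ X)
    (hGY : ∫ x in ball (0 : EuclideanSpace ℝ (Fin 3)) R' ∩ {x | ℓ₁ ≤ x 2}, G x ≤ Y) :
    ∃ s ∈ Icc ℓ₁ ℓ₂,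
      ∫ a, (ball (0 : EuclideanSpace ℝ (Fin 3)) R').indicator F (plane s a) ≤ X / (η * (ℓ₂ - ℓ₁)) ∧
      ∫ a, (ball (0 : EuclideanSpace ℝ (Fin 3)) R').indicator G (plane s a) ≤
        3 * Y / ((ℓ₁ + (1 - η) * (ℓ₂ - ℓ₁)) ^ 3 - ℓ₁ ^ 3) * s ^ 2 := by
  set hF : ℝ → ℝ := fun s => ∫ a, (ball (0 : EuclideanSpace ℝ (Fin 3)) R').indicator F (plane s a) with hhF
  set hG : ℝ → ℝ := fun s => ∫ a, (ball (0 : EuclideanSpace ℝ (Fin 3)) R').indicator G (plane s a) with hhG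
  -- the slab slice function: total `≤ Y`, equal to `hG` on `[ℓ₁, ∞)`
  set hGs : ℝ → ℝ := fun s =>
    ∫ a, (ball (0 : EuclideanSpace ℝ (Fin 3)) R' ∩ {x | ℓ₁ ≤ x 2}).indicator G (plane s a) with hhGs
  have hFint : Integrable hF := integrable_integral_plane _ (integrable_indicator_ball_of_continuous hFc R')
  have hGint : Integrable hG := integrable_integral_plane _ (integrable_indicator_ball_of_continuous hGc R')
  have hGsint : Integrable hGs := integrable_integral_plane _ (integrable_indicator_ballSlab_of_continuous hGc R' ℓ₁)
  have hFnn : ∀ s, 0 ≤ hF s := fun s => integral_indicator_plane_nonneg hF0 R' s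
  have hGsnn : ∀ s, 0 ≤ hGs s := fun s => integral_indicator_ballSlab_plane_nonneg hG0 R' ℓ₁ s
  have hFtot : ∫ s, hF s ≤ X := by rw [hhF, integral_integral_indicator_plane hFc R']; exact hFX
  have hGstot : ∫ s, hGs s ≤ Y := by rw [hhGs, integral_integral_indicator_ballSlab_plane hGc R' ℓ₁]; exact hGY
  have hGs_eq : ∀ s, ℓ₁ ≤ s → hGs s = hG s := by
    intro s hs
    simp only [hhGs, hhG]
    exact integral_congr_ae (ae_of_all _ fun a => indicator_ballSlab_plane_of_le hs a)
  have hℓ21 : 0 < ℓ₂ - ℓ₁ := by linarith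
  set μ₀ : ℝ := (1 - η) * (ℓ₂ - ℓ₁) with hμ₀
  have hμ₀pos : 0 < μ₀ := by rw [hμ₀]; exact mul_pos (by linarith) hℓ21
  set tF : ℝ := X / (η * (ℓ₂ - ℓ₁)) with htF
  have htFpos : 0 < tF := by rw [htF]; positivity
  -- Markov for `F` on `[ℓ₁, ℓ₂]`
  set J : Set ℝ := Icc ℓ₁ ℓ₂ with hJ
  have hJm : MeasurableSet J := measurableSet_Icc
  have hJvol : volume.real J = ℓ₂ - ℓ₁ := by
    rw [hJ, Real.volume_real_Icc_of_le hℓ.le]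
  have hBad : volume.real ({s | tF ≤ hF s} ∩ J) ≤ η * (ℓ₂ - ℓ₁) := by
    have hM := mul_meas_ge_le_integral_of_nonneg (μ := volume.restrict J) (ae_of_all _ hFnn) hFint.restrict tF
    have hset : ∫ s in J, hF s ≤ X := (setIntegral_le_integral hFint (ae_of_all _ hFnn)).trans hFtot
    rw [measureReal_restrict_apply' hJm] at hM
    have hle : tF * volume.real ({s | tF ≤ hF s} ∩ J) ≤ X := hM.trans hset
    have e : X = tF * (η * (ℓ₂ - ℓ₁)) := by rw [htF]; field_simp
    rw [e] at hle
    exact le_of_mul_le_mul_left hle htFpos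
  -- measurability of the ball slice function of `F`
  have hmeas : ∀ {Φ : EuclideanSpace ℝ (Fin 3) → ℝ}, Continuous Φ →
      Measurable fun s => ∫ a, (ball (0 : EuclideanSpace ℝ (Fin 3)) R').indicator Φ (plane s a) := by
    intro Φ hΦ
    have hH : Measurable ((ball (0 : EuclideanSpace ℝ (Fin 3)) R').indicator Φ) := hΦ.measurable.indicator measurableSet_ball
    have h1 : StronglyMeasurable (uncurry fun (s : ℝ) (a : EuclideanSpace ℝ (Fin 2)) =>
        (ball (0 : EuclideanSpace ℝ (Fin 3)) R').indicator Φ (plane s a)) := by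
      have e : (uncurry fun (s : ℝ) (a : EuclideanSpace ℝ (Fin 2)) =>
          (ball (0 : EuclideanSpace ℝ (Fin 3)) R').indicator Φ (plane s a)) =
          fun p => (ball (0 : EuclideanSpace ℝ (Fin 3)) R').indicator Φ (planeEquiv.symm p) := by
        funext p; rw [uncurry, ← planeEquiv_symm_apply]
      rw [e]; exact (hH.comp planeEquiv.symm.measurable).stronglyMeasurable
    exact (h1.integral_prod_right (ν := volume)).measurable
  have hFm : Measurable hF := hmeas hFc
  -- the good set
  set S : Set ℝ := J ∩ {s | hF s < tF} with hSdef
  have hSm : MeasurableSet S := hJm.inter (measurableSet_lt hFm measurable_const)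
  have hSJ : S ⊆ J := inter_subset_left
  have hJfin : volume J ≠ ⊤ := measure_Icc_lt_top.ne
  have hSvol : μ₀ ≤ volume.real S := by
    have hsplit := measureReal_inter_add_sdiff (μ := volume) (s := J) (t := {s | tF ≤ hF s})
      (measurableSet_le measurable_const hFm) hJfin
    have e1 : J ∩ {s | tF ≤ hF s} = {s | tF ≤ hF s} ∩ J := inter_comm _ _
    have e2 : J \ {s | tF ≤ hF s} = S := by
      ext s
      simp only [hSdef, Set.mem_sdiff, mem_inter_iff, mem_setOf_eq, not_le]
    rw [e1, e2, hJvol] at hsplit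
    rw [hμ₀]
    nlinarith [hBad, hsplit]
  -- the `G`-threshold
  set lam : ℝ := 3 * Y / ((ℓ₁ + (1 - η) * (ℓ₂ - ℓ₁)) ^ 3 - ℓ₁ ^ 3) with hlam
  have hbase : ℓ₁ < ℓ₁ + (1 - η) * (ℓ₂ - ℓ₁) := by nlinarith
  have hden : 0 < (ℓ₁ + (1 - η) * (ℓ₂ - ℓ₁)) ^ 3 - ℓ₁ ^ 3 := by
    have h2 := pow_lt_pow_left₀ hbase hℓ₁.le (n := 3) (by norm_num)
    linarith
  have hlampos : 0 < lam := by rw [hlam]; positivity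
  -- bathtub: `lam · ∫_S s² ≥ Y`
  have hbath := setIntegral_sq_ge_bathtub hℓ₁.le hμ₀pos.le hSm hSJ hSvol
  have hIcc : ∫ s in Icc ℓ₁ (ℓ₁ + μ₀), s ^ 2 = ((ℓ₁ + μ₀) ^ 3 - ℓ₁ ^ 3) / 3 := by
    rw [integral_Icc_eq_integral_Ioc, ← intervalIntegral.integral_of_le (by linarith), integral_pow]; norm_num
  have hkey : Y ≤ lam * ∫ s in S, s ^ 2 := by
    have e : lam * (((ℓ₁ + μ₀) ^ 3 - ℓ₁ ^ 3) / 3) = Y := by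
      have hden' := ne_of_gt hden
      rw [hlam, hμ₀]
      field_simp
    calc Y = lam * (((ℓ₁ + μ₀) ^ 3 - ℓ₁ ^ 3) / 3) := e.symm
      _ = lam * ∫ s in Icc ℓ₁ (ℓ₁ + μ₀), s ^ 2 := by rw [hIcc]
      _ ≤ lam * ∫ s in S, s ^ 2 := mul_le_mul_of_nonneg_left hbath hlampos.le
  -- conclusion by contradiction
  by_contra hcon
  push Not at hcon
  -- on `S`: `hGs s = hG s > lam s²`
  have hstrict : ∀ s ∈ S, lam * s ^ 2 < hGs s := by
    intro s hs
    have hsJ : s ∈ Icc ℓ₁ ℓ₂ := hSJ hs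
    have hFs : hF s ≤ tF := le_of_lt hs.2
    rw [hGs_eq s hsJ.1]
    exact hcon s hsJ hFs
  have hi2 : IntegrableOn (fun s : ℝ => lam * s ^ 2) S volume :=
    ((continuous_const.mul (continuous_id.pow 2) : Continuous fun s : ℝ => lam * s ^ 2).continuousOn.integrableOn_compact
      isCompact_Icc).mono_set hSJ
  have hintS : IntegrableOn (fun s => hGs s - lam * s ^ 2) S volume := (hGsint.integrableOn).sub hi2
  have hpos : 0 < ∫ s in S, (hGs s - lam * s ^ 2) := by
    rw [setIntegral_pos_iff_support_of_nonneg_ae ?_ hintS]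
    · have hSsub : S ⊆ support (fun s => hGs s - lam * s ^ 2) ∩ S := fun s hs =>
        ⟨Function.mem_support.2 (ne_of_gt (sub_pos.2 (hstrict s hs))), hs⟩
      have hSpos : 0 < volume S := by
        have h := hSvol
        rw [measureReal_def] at h
        exact ENNReal.toReal_pos_iff.1 (hμ₀pos.trans_le h) |>.1
      exact hSpos.trans_le (measure_mono hSsub)
    · filter_upwards [ae_restrict_mem hSm] with s hs
      exact (sub_pos.2 (hstrict s hs)).le
  have hsplit : ∫ s in S, (hGs s - lam * s ^ 2) = (∫ s in S, hGs s) - lam * ∫ s in S, s ^ 2 := by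
    rw [integral_sub hGsint.integrableOn hi2, integral_const_mul]
  have hGS : ∫ s in S, hGs s ≤ Y := (setIntegral_le_integral hGsint (ae_of_all _ hGsnn)).trans hGstot
  rw [hsplit] at hpos
  linarith

/-- **`NsregP2.R46.WeightedQuietSliceShell`, binder-for-binder** (Sketch46 of nsreg-p2 g36, sha16 7c4c548940e39666, plate t48-Q″;
`E3` spelled out, `plane` = `Condenser.plane`). [folklore (Markov, bathtub principle)] -/
theorem weightedQuietSliceShell :
    ∀ (F G : EuclideanSpace ℝ (Fin 3) → ℝ), Continuous F → Continuous G → (∀ x, 0 ≤ F x) → (∀ x, 0 ≤ G x) →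
      ∀ (ℓ₁ ℓ₂ R' η X Y : ℝ), 0 < ℓ₁ → ℓ₁ < ℓ₂ → 0 < η → η < 1 → 0 < X → 0 < Y →
        (∫ x in ball (0 : EuclideanSpace ℝ (Fin 3)) R', F x ≤ X) →
        (∫ x in ball (0 : EuclideanSpace ℝ (Fin 3)) R' ∩ {x : EuclideanSpace ℝ (Fin 3) | ℓ₁ ≤ x 2}, G x ≤ Y) →
        ∃ s ∈ Icc ℓ₁ ℓ₂,
          ∫ a, (ball (0 : EuclideanSpace ℝ (Fin 3)) R').indicator F (plane s a) ≤ X / (η * (ℓ₂ - ℓ₁)) ∧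
          ∫ a, (ball (0 : EuclideanSpace ℝ (Fin 3)) R').indicator G (plane s a) ≤
            3 * Y / ((ℓ₁ + (1 - η) * (ℓ₂ - ℓ₁)) ^ 3 - ℓ₁ ^ 3) * s ^ 2 :=
  fun _ _ hFc hGc hF0 hG0 _ _ _ _ _ _ hℓ₁ hℓ hη hη1 hX hY hFX hGY =>
    weightedQuietSliceShell_of hFc hGc hF0 hG0 hℓ₁ hℓ hη hη1 hX hY hFX hGY

end Summit.NavierStokesRegularity.NavierStokesRegularity.Theorems.PowerGaugeEulerLiouville.Condenser

end
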